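import Mathlib
import Literature.Combinatorics.Additive.PollardFourThirds
import Summits.MatrixMultiplication.MatrixMultiplication.Theorems.AbelianSTPPCensusVPFibre

/-!
# Rule U11-KP of the abelian STPP census: the Kneser–Pollard floor `t(P_AB + P_BC) − t² − loss_B(t)`, CONDITIONAL on Grynkiewicz–Wang's Conjecture 2.2

Cell mm-stpp (rung F-M1), theory lane gen 15, «past the QUARTET's walls» (census-silent).  The registered sumset rules of the census —
U11-G ([Gry10] Thm 1.1, floor `t(P_AB + P_BC) − 2t² + 1`), U11-G′ (Grynkiewicz–Wang 2026 Thm 1.8, floor `t(P_AB + P_BC) − ⌊(4t² − 2t)/3⌋`,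
file `AbelianSTPPCensusU11GPrime`) and U11-P (Pollard 1974 at PRIME orders, floor `t·min(p, P_AB + P_BC − t)`) — compare a floor for
`N_t(X, Y) = Σ_w min(t, r_{X,Y}(w))` (`X = ⋃ (B_j − A_j)`, `Y = ⋃ (C_k − B_k)`) with the bookkeeping ceiling `UB_B(t)` (`STPPRepCount.Nt_le_ubB`).
Past the quartet's walls (theory g14, `AbelianSTPPCensusQuartetWitnesses`: T_E 594, T_D 832, T_C 3 638 / 3 655, T_A 7 675, T_B 7 128) the alive
lists sit within `0.5 – 4.4 %` of the Grynkiewicz–Wang constant `4/3`; the conjectured common generalisation of the theorems of Kneser and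
Pollard — **Grynkiewicz–Wang 2026, Conjecture 2.2** (arXiv:2601.17922, §2.1, p. 11; OPEN) — has the constant `1`:

«Let `t` be a positive integer, let `G` be an abelian group, and let `A, B ⊆ G` be finite subsets with `|A|, |B| ≥ t`.  If
`Σ_{i=1}^t |A +_i B| < t|A| + t|B| − t²`, then there exist subsets `A′ ⊆ A` and `B′ ⊆ B` such that `|A ∖ A′| + |B ∖ B′| < u`,
`A′ + B′ = A′ +_u B′ = A +_u B`, `H := 𝖧(A′ + B′) = 𝖧(A′ +_u B′) = 𝖧(A +_t B)`, and `Σ_{i=1}^t |A +_i B| ≥ t|A| + t|B| − t² − u(|H| − u)`,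
where `t = s|H| + u` with `u ∈ [1, |H|]` and `s ≥ 0` integers.»

This file does NOT assert the conjecture.  It records it as a PREDICATE on the data `(A, B, t)` (`KneserPollardConclusion A B t`, the printed
conclusion verbatim), derives the consumer dichotomy the census needs (`KneserPollardDichotomy A B t`: the floor `t|A| + t|B| − t² ≤ N_t`, or
`u ≤ t` and `A′, B′` with fewer than `u` exceptions and every element of `A′ + B′` `u`-popular in `A + B`, where either `u = t` or `2u ≤ t` and
the floor holds up to `u(t − 2u)`) from the printed form (`kneserPollardDichotomy_of_conclusion`: if `t = s|H| + u` with `s ≥ 1` then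
`|H| − u ≤ t − 2u`), and proves the rule below SOUND UNDER THE HYPOTHESIS that the dichotomy holds for all data:

* `lossKP a b c t = max {u(t − 2u) : 1 ≤ u, 2u ≤ t, L_B(u) < u}` (`0` if there is no such `u`) — the largest conjectured loss over the small
  periods `u` that the fibre lemma (`STPPRepCount.lB_le_card_sdiff_add`: `u`-popular `X′ + Y′` costs at least `L_B(u)` exceptions) cannot exclude;
* `U11KPFormB M a b c` — **rule U11-KP, form B**: for every `t` with `1 ≤ t ≤ min(P_AB, P_BC)` and `t ≤ L_B(t)`:
  `t (P_AB + P_BC) ≤ UB_B(t) + t² + lossKP(t)`; same `pAB`, `pBC`, `ubB`, `lB` as `U11G` / `U11GPrime`;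
* `U11KP M a b c` — the three letter forms (B; A = letters `(c, a, b)`; C = letters `(b, c, a)`);
* `u11KPFormB_of_kneserPollard`, `u11KP_of_kneserPollard`, `u11KPSound_of_kneserPollard` — **conditional soundness**: IF the Kneser–Pollard
  dichotomy holds for all finite `A, B` in all abelian groups and all `1 ≤ t ≤ min(|A|, |B|)`, THEN the shape data of every `IsSTPP` family
  with non-empty sets in a finite abelian group `H` is `U11KP |H|`.  At PRIME orders the hypothesis is Pollard's theorem and the registered rule
  U11-P is already unconditionally sound (`u11PSound`); this file adds nothing there.

The kills of the six quartet-alive lists under U11-KP are `AbelianSTPPCensusU11KPWalls.lean`.  Exact Python twin: seat folder `calc/u11c.py`.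
WHAT THIS IS NOT: not a theorem that STPP families satisfy U11-KP (that is CONDITIONAL on an open conjecture, stated as an explicit hypothesis —
no Literature fact, no `@[conjecture]` item is filed here); no census number; no `ω` statement.  Its content is the exact statement «the lever
past the quartet is Conjecture 2.2»: the conditional kills are kernel facts, the condition is print-open.

## References
* D. J. Grynkiewicz, R. Wang, *Pollard's theorem in general abelian groups*, arXiv:2601.17922 (2026), §2.1 Conjecture 2.2 (open) and
  Theorem 1.8 [tree: `Literature.Combinatorics.Additive.PollardFourThirds`, kernel].
* D. J. Grynkiewicz, Israel J. Math. 177 (2010) 413–439, Thm 1.1 (rule U11-G); J. M. Pollard, J. London Math. Soc. (2) 8 (1974) 460–462 (U11-P).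
* H. Cohn, R. Kleinberg, B. Szegedy, C. Umans, FOCS 2005, Def. 5.1 (`IsSTPP`).
-/

set_option linter.dupNamespace false -- `MatrixMultiplication.MatrixMultiplication` (summit = problem, D-0017)
set_option autoImplicit false

namespace Summit.MatrixMultiplication.MatrixMultiplication.Theorems

open Finset Literature.Computability.AlgebraicComplexity Literature.Combinatorics.Additive
open scoped Pointwise

/-! ### The printed conclusion of Conjecture 2.2 and the consumer dichotomy (predicates on the data; nothing is asserted) -/

namespace KneserPollard

variable {G : Type*} [AddCommGroup G] [DecidableEq G]

/-- **The conclusion of Grynkiewicz–Wang 2026 Conjecture 2.2 for the data `(A, B, t)`** (verbatim, §2.1 p. 11 of arXiv:2601.17922):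
there are `A′ ⊆ A`, `B′ ⊆ B` and integers `s ≥ 0`, `u ∈ [1, |H|]` with `t = s|H| + u`, where `H = 𝖧(A′ + B′)` (the tree's `Finset.addStab`),
such that `|A ∖ A′| + |B ∖ B′| < u`, `A′ + B′ = A′ +_u B′` and `A′ + B′ = A +_u B` (as filter identities on `r_{A′,B′}` / `r_{A,B}` =
`Pollard.rep`), `H = 𝖧(A +_t B)` (the printed `𝖧(A′ +_u B′) = 𝖧(A′ + B′)` is the same set by the first identity), and
`t|A| + t|B| − t² − u(|H| − u) ≤ Σ_{x ∈ A + B} min(t, r_{A,B}(x))` (over `ℤ`).  A predicate; the conjecture «hypothesis ⇒ this» is OPEN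
and is used below only as an explicit hypothesis. [cite: GrynkiewiczWang2026, Conj 2.2] -/
def KneserPollardConclusion (A B : Finset G) (t : ℕ) : Prop :=
  ∃ A' ⊆ A, ∃ B' ⊆ B, ∃ s u : ℕ,
    let H : Finset G := (A' + B').addStab
    1 ≤ u ∧ u ≤ H.card ∧ t = s * H.card + u ∧
    (A \ A').card + (B \ B').card < u ∧
    (A' + B').filter (fun x => u ≤ Pollard.rep A' B' x) = A' + B' ∧
    A' + B' = (A + B).filter (fun x => u ≤ Pollard.rep A B x) ∧
    H = ((A + B).filter (fun x => t ≤ Pollard.rep A B x)).addStab ∧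
    (t : ℤ) * A.card + t * B.card - t * t - u * ((H.card : ℤ) - u) ≤
      ((∑ x ∈ A + B, min t (Pollard.rep A B x) : ℕ) : ℤ)

/-- **The Kneser–Pollard dichotomy for the data `(A, B, t)`** — the consumer form of Conjecture 2.2 (cf. `grynkiewiczWang2026_thm_1_8_weak`):
either the Pollard floor `t|A| + t|B| ≤ Σ_{x ∈ A+B} min(t, r_{A,B}(x)) + t²`, or there are `1 ≤ u ≤ t` and `A′ ⊆ A`, `B′ ⊆ B` with fewer than `u`
exceptions and every element of `A′ + B′` having at least `u` representations in `A + B`, where either `u = t`, or `2u ≤ t` and the floor holds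
up to the loss `u(t − 2u)`.  A predicate (no claim); implied by the printed conclusion (`kneserPollardDichotomy_of_conclusion`). [original] -/
def KneserPollardDichotomy (A B : Finset G) (t : ℕ) : Prop :=
  t * A.card + t * B.card ≤ (∑ x ∈ A + B, min t (Pollard.rep A B x)) + t * t ∨
  ∃ u : ℕ, ∃ A' ⊆ A, ∃ B' ⊆ B, 1 ≤ u ∧ u ≤ t ∧ (A \ A').card + (B \ B').card < u ∧
    (∀ x ∈ A' + B', u ≤ Pollard.rep A B x) ∧
    (u = t ∨ (2 * u ≤ t ∧
      t * A.card + t * B.card ≤ (∑ x ∈ A + B, min t (Pollard.rep A B x)) + t * t + u * (t - 2 * u)))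

/-- **Printed form ⇒ consumer form.**  If the floor `t|A| + t|B| − t² ≤ Σ` fails and the printed conclusion of Conjecture 2.2 holds for
`(A, B, t)`, the dichotomy holds: with `t = s|H| + u`, `1 ≤ u ≤ |H|`, either `s = 0` (then `u = t`) or `s ≥ 1`, in which case `|H| ≤ t − u`,
so `2u ≤ t` and `u(|H| − u) ≤ u(t − 2u)`; the elements of `A′ + B′ = A +_u B` are `u`-popular in `A + B`. [original] -/
theorem kneserPollardDichotomy_of_conclusion (A B : Finset G) (t : ℕ)
    (h : t * A.card + t * B.card ≤ (∑ x ∈ A + B, min t (Pollard.rep A B x)) + t * t ∨ KneserPollardConclusion A B t) :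
    KneserPollardDichotomy A B t := by
  rcases h with hfloor | hconc
  · exact Or.inl hfloor
  obtain ⟨A', hA', B', hB', s, u, hu1, huH, htsu, hl, -, hpopset, -, hbound⟩ := hconc
  right
  refine ⟨u, A', hA', B', hB', hu1, ?_, hl, ?_, ?_⟩
  · -- `u ≤ t` from `t = s|H| + u`
    rw [htsu]; exact Nat.le_add_left u _
  · intro x hx
    rw [hpopset, mem_filter] at hx
    exact hx.2
  · rcases Nat.eq_zero_or_pos s with hs | hs
    · left; rw [htsu, hs, zero_mul, zero_add]
    · right
      set S : ℕ := ∑ x ∈ A + B, min t (Pollard.rep A B x) with hS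
      set h : ℕ := (A' + B').addStab.card with hh
      have hhu : h ≤ t - u := by
        have : h ≤ s * h := Nat.le_mul_of_pos_left h hs
        omega
      refine ⟨by omega, ?_⟩
      -- over ℤ: `u(|H| − u) ≤ u(t − 2u)` and the printed bound
      have hsub : ((t - 2 * u : ℕ) : ℤ) = (t : ℤ) - 2 * u := by
        have : 2 * u ≤ t := by omega
        push_cast [Nat.cast_sub this]; ring
      have hmono : (u : ℤ) * ((h : ℤ) - u) ≤ (u : ℤ) * ((t : ℤ) - 2 * u) := by
        apply mul_le_mul_of_nonneg_left _ (by positivity)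
        have : (h : ℤ) ≤ (t : ℤ) - u := by
          have := hhu; omega
        linarith
      have key : (t : ℤ) * A.card + t * B.card ≤ (S : ℤ) + t * t + u * ((t : ℤ) - 2 * u) := by
        linarith
      have : ((t * A.card + t * B.card : ℕ) : ℤ) ≤ ((S + t * t + u * (t - 2 * u) : ℕ) : ℤ) := by
        push_cast [hsub]; linarith
      exact_mod_cast this

end KneserPollard

/-! ### Rule U11-KP (shape level) -/

variable {N : ℕ}

/-- The conjectured loss of rule U11-KP in form B at parameter `t`: `max {u·(t − 2u) : 1 ≤ u < t, 2u ≤ t, L_B(u) < u}` — the largest term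
`u(|H| − u) ≤ u(t − 2u)` of Conjecture 2.2 over the small periods `u` that the fibre lemma cannot exclude (`L_B(u) < u`); the `Finset.sup` of the
empty set is `0` (no loss), which is the intended value.  Computable (kills by `decide`). [original] -/
def lossKP (a b c : Fin N → ℕ) (t : ℕ) : ℕ :=
  ((range t).filter fun u => 1 ≤ u ∧ 2 * u ≤ t ∧ lB a b c u < u).sup fun u => u * (t - 2 * u)

/-- **Rule U11-KP, form B** (Kneser–Pollard floor): for every `t` with `1 ≤ t ≤ min(P_AB, P_BC)` and `t ≤ L_B(t)`,
`t (P_AB + P_BC) ≤ UB_B(t) + t² + lossKP(t)`.  Same bookkeeping functions `pAB`, `pBC`, `ubB`, `lB` as `U11GFormB` / `U11GPrimeFormB`.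
Sound for STPP shape data CONDITIONALLY on the Kneser–Pollard dichotomy (`u11KPFormB_of_kneserPollard`).  No claim by itself. [original] -/
def U11KPFormB (M : ℕ) (a b c : Fin N → ℕ) : Prop :=
  ∀ t : ℕ, 1 ≤ t → t ≤ pAB a b c → t ≤ pBC a b c → t ≤ lB a b c t →
    t * (pAB a b c + pBC a b c) ≤ ubB M a b c t + t * t + lossKP a b c t

/-- **Rule U11-KP, all three letter forms** (B; A = the rule for the rotated family `(C, A, B)`, letters `(c, a, b)`; C = the rotated family
`(B, C, A)`, letters `(b, c, a)`), as for `U11G` / `U11GPrime`.  No claim by itself. [original] -/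
def U11KP (M : ℕ) (a b c : Fin N → ℕ) : Prop :=
  U11KPFormB M a b c ∧ U11KPFormB M c a b ∧ U11KPFormB M b c a

/-- **Conditional soundness of rule U11-KP, form B.**  HYPOTHESIS `hKP`: the Kneser–Pollard dichotomy (`KneserPollard.KneserPollardDichotomy`,
the consumer form of Grynkiewicz–Wang 2026 Conjecture 2.2 — OPEN) holds for all finite `A, B` in every abelian group and every
`1 ≤ t ≤ min(|A|, |B|)`.  CONCLUSION: for an STPP family with non-empty sets in a finite abelian group `H`, with `X = ⋃ (B_j − A_j)`,
`Y = ⋃ (C_k − B_k)` (`|X| = P_AB`, `|Y| = P_BC`): at a parameter `t ≤ L_B(t)`, the dichotomy for `(X, Y, t)` gives either the floor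
`t(P_AB + P_BC) ≤ N_t + t²` (closed by the ceiling `N_t ≤ UB_B(t)`, `STPPRepCount.Nt_le_ubB`), or `u`-popular `X′ + Y′` with fewer than `u`
exceptions: the fibre lemma `STPPRepCount.lB_le_card_sdiff_add` gives `L_B(u) < u`, so `u ≠ t` (as `t ≤ L_B(t)`), hence `2u ≤ t` and the floor up
to `u(t − 2u) ≤ lossKP(t)`.  CONDITIONAL result: nothing here proves the hypothesis. [original] -/
theorem u11KPFormB_of_kneserPollard
    (hKP : ∀ (G : Type) [AddCommGroup G] [DecidableEq G] (A B : Finset G) (t : ℕ),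
      1 ≤ t → t ≤ A.card → t ≤ B.card → KneserPollard.KneserPollardDichotomy A B t)
    {H : Type} [AddCommGroup H] [Fintype H] [DecidableEq H]
    {A B C : Fin N → Finset H} (h : IsSTPP A B C)
    (hA : ∀ i, (A i).Nonempty) (hB : ∀ i, (B i).Nonempty) (hC : ∀ i, (C i).Nonempty) :
    U11KPFormB (Fintype.card H) (fun i => (A i).card) (fun i => (B i).card) (fun i => (C i).card) := by
  intro t ht1 htX htY htL
  have hXc : (diffUnion A B).card = pAB (fun i => (A i).card) (fun i => (B i).card) (fun i => (C i).card) :=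
    STPPRepCount.card_diffUnion_AB h hC
  have hYc : (diffUnion B C).card = pBC (fun i => (A i).card) (fun i => (B i).card) (fun i => (C i).card) :=
    STPPRepCount.card_diffUnion_BC h hA
  -- the Literature sum over `X + Y` is at most the tree's `N_t` (a sum over the whole group; `repCount = Pollard.rep` by `rfl`)
  have hsub : (∑ x ∈ diffUnion A B + diffUnion B C, min t (Pollard.rep (diffUnion A B) (diffUnion B C) x)) ≤
      Nt (diffUnion A B) (diffUnion B C) t := by
    unfold Nt
    exact sum_le_sum_of_subset (subset_univ _)
  have hceil := STPPRepCount.Nt_le_ubB h hB t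
  rcases hKP H (diffUnion A B) (diffUnion B C) t ht1 (hXc ▸ htX) (hYc ▸ htY) with hfloor | ⟨u, X', -, Y', -, hu1, hut, hl, hpop, halt⟩
  · rw [hXc, hYc] at hfloor
    rw [mul_add]
    calc t * pAB _ _ _ + t * pBC _ _ _
        ≤ (∑ x ∈ diffUnion A B + diffUnion B C, min t (Pollard.rep (diffUnion A B) (diffUnion B C) x)) + t * t := hfloor
      _ ≤ ubB (Fintype.card H) _ _ _ t + t * t := Nat.add_le_add_right (hsub.trans hceil) _
      _ ≤ _ := Nat.le_add_right _ _
  · have hpop' : ∀ x ∈ X', ∀ y ∈ Y', u ≤ repCount (diffUnion A B) (diffUnion B C) (x + y) :=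
      fun x hx y hy => hpop (x + y) (add_mem_add hx hy)
    have hf := STPPRepCount.lB_le_card_sdiff_add h hA hC hpop'
    -- `L_B(u) < u`, so `u ≠ t`
    rcases halt with rfl | ⟨h2u, hbound⟩
    · exfalso; omega
    · rw [hXc, hYc] at hbound
      have hmem : u ∈ (range t).filter fun u => 1 ≤ u ∧ 2 * u ≤ t ∧
          lB (fun i => (A i).card) (fun i => (B i).card) (fun i => (C i).card) u < u := by
        rw [mem_filter, mem_range]
        exact ⟨by omega, hu1, h2u, by omega⟩
      have hloss : u * (t - 2 * u) ≤ lossKP (fun i => (A i).card) (fun i => (B i).card) (fun i => (C i).card) t :=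
        le_sup (f := fun u => u * (t - 2 * u)) hmem
      rw [mul_add]
      calc t * pAB _ _ _ + t * pBC _ _ _
          ≤ (∑ x ∈ diffUnion A B + diffUnion B C, min t (Pollard.rep (diffUnion A B) (diffUnion B C) x)) + t * t +
              u * (t - 2 * u) := hbound
        _ ≤ ubB (Fintype.card H) _ _ _ t + t * t + lossKP _ _ _ t := by
            have := hsub.trans hceil
            omega

/-- **Conditional soundness of rule U11-KP, three letter forms**: forms A and C are form B of the rotated families `(C, A, B)`, `(B, C, A)`
(`IsSTPP.rotate`).  Hypothesis as in `u11KPFormB_of_kneserPollard`. [original] -/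
theorem u11KP_of_kneserPollard
    (hKP : ∀ (G : Type) [AddCommGroup G] [DecidableEq G] (A B : Finset G) (t : ℕ),
      1 ≤ t → t ≤ A.card → t ≤ B.card → KneserPollard.KneserPollardDichotomy A B t)
    {H : Type} [AddCommGroup H] [Fintype H] [DecidableEq H]
    {A B C : Fin N → Finset H} (h : IsSTPP A B C)
    (hne : ∀ i, (A i).Nonempty ∧ (B i).Nonempty ∧ (C i).Nonempty) :
    U11KP (Fintype.card H) (fun i => (A i).card) (fun i => (B i).card) (fun i => (C i).card) :=
  ⟨u11KPFormB_of_kneserPollard hKP h (fun i => (hne i).1) (fun i => (hne i).2.1) (fun i => (hne i).2.2),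
    u11KPFormB_of_kneserPollard hKP h.rotate.rotate (fun i => (hne i).2.2) (fun i => (hne i).1) (fun i => (hne i).2.1),
    u11KPFormB_of_kneserPollard hKP h.rotate (fun i => (hne i).2.1) (fun i => (hne i).2.2) (fun i => (hne i).1)⟩

/-- **`U11KPSound` under the Kneser–Pollard hypothesis** — rule U11-KP in the census's item format (as `u11GPrimeSound`): IF the dichotomy
holds universally THEN every STPP family with non-empty sets in a finite abelian group `H` satisfies `U11KP |H|` at its shape list.
CONDITIONAL (the hypothesis is the consumer form of an open conjecture). [original] -/
theorem u11KPSound_of_kneserPollard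
    (hKP : ∀ (G : Type) [AddCommGroup G] [DecidableEq G] (A B : Finset G) (t : ℕ),
      1 ≤ t → t ≤ A.card → t ≤ B.card → KneserPollard.KneserPollardDichotomy A B t) :
    ∀ (H : Type) [AddCommGroup H] [Fintype H] (N : ℕ) (A B C : Fin N → Finset H), IsSTPP A B C →
      (∀ i, (A i).Nonempty ∧ (B i).Nonempty ∧ (C i).Nonempty) →
        U11KP (Fintype.card H) (fun i => (A i).card) (fun i => (B i).card) (fun i => (C i).card) := by
  intro H _ _ N A B C h hne
  classical
  exact u11KP_of_kneserPollard hKP h hne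

/-- **The printed conjecture implies the hypothesis.**  If Conjecture 2.2 holds as printed — for all finite `A, B` with `|A|, |B| ≥ t ≥ 1` whose
popular-sum count is below the Pollard floor, the printed conclusion `KneserPollard.KneserPollardConclusion A B t` — then the Kneser–Pollard
dichotomy holds for all data, so every `…_of_kneserPollard` theorem of this file applies. [original] -/
theorem kneserPollard_of_printed
    (hC : ∀ (G : Type) [AddCommGroup G] [DecidableEq G] (A B : Finset G) (t : ℕ),
      1 ≤ t → t ≤ A.card → t ≤ B.card →
      (∑ x ∈ A + B, min t (Pollard.rep A B x)) + t * t < t * A.card + t * B.card →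
      KneserPollard.KneserPollardConclusion A B t) :
    ∀ (G : Type) [AddCommGroup G] [DecidableEq G] (A B : Finset G) (t : ℕ),
      1 ≤ t → t ≤ A.card → t ≤ B.card → KneserPollard.KneserPollardDichotomy A B t := by
  intro G _ _ A B t ht hA hB
  apply KneserPollard.kneserPollardDichotomy_of_conclusion
  by_cases hlt : (∑ x ∈ A + B, min t (Pollard.rep A B x)) + t * t < t * A.card + t * B.card
  · exact Or.inr (hC G A B t ht hA hB hlt)
  · exact Or.inl (by omega)

/-- At a prime order the hypothesis is not needed for form B's floor without loss: the registered rule U11-P (`U11PFormB`, Pollard's theorem,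
`u11PSound`) already gives `t·min(p, P_AB + P_BC − t) ≤ UB_B(t)`; when `P_AB + P_BC − t ≤ p` this is `t(P_AB + P_BC) ≤ UB_B(t) + t²`, which implies
U11-KP's clause at that `t`.  [bookkeeping] -/
theorem u11KPFormB_clause_of_u11P {M : ℕ} {a b c : Fin N → ℕ} (hP : U11PFormB M a b c) {t : ℕ} (ht1 : 1 ≤ t)
    (htX : t ≤ pAB a b c) (htY : t ≤ pBC a b c) (hthin : pAB a b c + pBC a b c - t ≤ M) :
    t * (pAB a b c + pBC a b c) ≤ ubB M a b c t + t * t + lossKP a b c t := by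
  have key := hP t ht1 htX htY
  rw [min_eq_right hthin, Nat.mul_sub, Nat.sub_le_iff_le_add] at key
  omega

end Summit.MatrixMultiplication.MatrixMultiplication.Theorems
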